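import Summits.ResolutionOfSingularities.ResolutionOfSingularities.Theorems.HilbertSamuelEliminationSigmaMaxModificationsCorridor3Directrix214SharpCentreBase
import Literature.AlgebraicGeometry.CossartJannsenSaito2020.NearPointDirectrix
import Literature.AlgebraicGeometry.Resolution.HironakaGroupSchemeAdditiveGenerators
import HarnessLib

/-!
# [OURS · L1 W4.2] 2.14♯ for an ARBITRARY permissible centre, numerical form: the binder
# `Moving.Theorem314_geomDir` of the characteristic-2 row DISCHARGED from printed facts
# (`theorem314_geomDir_of_facts`)

Cell res-hironaka, rung L, slot W4.2 (crux `SigmaMaxModificationsCorridor3`, stmt-ResolutionOfSingularities-19249),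
typing item T7b (sequel of T7 = `…Corridor3Directrix214Sharp.lean`, the POINT-centre locus clause
`Directrix214Sharp`). [OURS · L1 W4.2] new-combination; NOT a statement of any source, and NOT a statement of
H. Hironaka's 2017 manuscript.

WHY. The row `stub_Wlow3M_two` consumes stub-3's binder `Moving.Theorem314_geomDir` (`…WLadderMovingTwoDefs`):
CJS Thm. 3.14 in numerical form («`x′` near to `x ∈ D` under the blow-up of a PERMISSIBLE centre `D` ⇒
`dim 𝒪_{D,x} < e_x(X)`») with the characteristic hypothesis (F1) replaced by (F1♯)
`GeomDirHypothesis X x` («`char k(x) = 0 ∨ ē_x(X) + 2 ≤ 2·char k(x)`»), instantiated at THE canonical centre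
through a marked point — a curve or a surface in general (`…MovingTwoBlownUpCentre`, `…MovingTwoGradeZero`).
The point clause `Directrix214Sharp` says nothing for `dim_x D ≥ 1`. This file proves the general-centre
statement from printed facts taken BY NAME:

* F-51′ `Hironaka1970_thmIV` ([H4] Th. IV for a permissible centre: the ideal `J_D` of the normal-cone fibre
  `C_{X,D,x}` is generated inside Hironaka's algebra `U(𝔭_{x′})` of the point `x′ ∈ ℙ(N_{D,x})`);
* F-52 `HironakaScheme.Hironaka1970_thm1_cor` and F-50b `HironakaScheme.Mizutani1973_vectorGroup_of_dim_le`
  (as in T7), through T7's ℙⁿ-assembly `directrixSpace_le_prime_of_facts` (REUSED, not restated):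
  `𝒯(J_D) ⊆ 𝔭_{x′}` as soon as `ē(C_{X,D,x}) + 2 ≤ 2p`;
* F-split `HerrmannIkedaOrbanz1988_cor_21_11` (Hironaka–Grothendieck isomorphism along a regular normally flat
  centre: `J_z = J_D · k[Z]` for the generating system `z = (g, y)` of `𝔪_x`), which transports the
  directrix numerics between `C_x(X)` and `C_{X,D,x}`: `e_x(X) ≥ e(C_{X,D,x}) + dim 𝒪_{D,x}` and
  `ē(C_{X,D,x}) ≤ ē_x(X)`;
* `CossartJannsenSaito2020_thm_3_14` (the printed theorem) for the branch `char k(x) = 0`.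

KERNEL STEPS (fact-free): `z = (g, y)` is a MINIMAL system of generators of `𝔪_x` when `g` is minimal for
`I_{D,x}` and `y` lifts a regular system of parameters of `𝒪_{D,x}` — read off the Hilbert function in degree
one (`H^{(0)}(1) = emb.dim`, `hilbertFunQuot_tangentConeIdeal`) since `J_D` has no forms of degree `≤ 1`
(Nakayama); `dim 𝒯(J · k[Z]) ≤ dim 𝒯(J)` (`finrank_directrixSpace_map_algHom_le`); the point `𝔭_{x′}` misses a
variable, so `𝒯(J_D) ⊆ 𝔭_{x′}` forces `e(C_{X,D,x}) ≥ 1`; hence `e_x(X) ≥ 1 + dim 𝒪_{D,x}`.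

AI-written (res-type-001 g7); AI review is weaker than expert review.
-/

set_option linter.dupNamespace false

noncomputable section

open CategoryTheory AlgebraicGeometry TopologicalSpace IsLocalRing MvPolynomial
open Literature.AlgebraicGeometry.Resolution Literature.AlgebraicGeometry.Resolution.HironakaScheme
open Literature.RingTheory.HilbertSamuel Literature.RingTheory.MvPolynomial
open Literature.AlgebraicGeometry.CossartJannsenSaito2020

namespace Summit.ResolutionOfSingularities.ResolutionOfSingularities.Theorems.SigmaMaxModificationsCorridor3.Directrix214Sharp

universe u v

/-! ## Small scheme lemmas -/

/-- A non-empty space of topological Krull dimension `≤ N` has dimension some natural number (copy of the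
tree's `Moving.exists_topologicalKrullDim_eq`, kept local to avoid a heavy import). [folklore; AI-written] -/
theorem exists_nat_topologicalKrullDim_eq {W : Type u} [TopologicalSpace W] (w : W) {N : ℕ}
    (hd : topologicalKrullDim W ≤ (N : WithBot ℕ∞)) : ∃ d : ℕ, topologicalKrullDim W = d := by
  have hbot : topologicalKrullDim W ≠ ⊥ := by
    unfold topologicalKrullDim
    rw [ne_eq, Order.krullDim_eq_bot_iff, not_isEmpty_iff]
    exact ⟨⟨closure {w}, isIrreducible_singleton.closure, isClosed_closure⟩⟩
  have hdt : (N : WithBot ℕ∞) ≠ ⊤ := ne_of_beq_false rfl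
  have htop : topologicalKrullDim W ≠ ⊤ := ne_top_of_le_ne_top hdt hd
  exact exists_nat_eq_of_ne_bot_of_ne_top hbot htop

/-- Minimal generators of a finitely generated ideal, as a function on `Fin μ(I)`. [folklore; AI-written] -/
theorem exists_fun_span_eq_of_fg {A : Type u} [CommRing A] {I : Ideal A} (hI : I.FG) :
    ∃ g : Fin I.spanFinrank → A, Ideal.span (Set.range g) = I := by
  classical
  obtain ⟨s, hs, hspan⟩ := Submodule.FG.exists_span_finset_card_eq_spanFinrank hI
  refine ⟨fun i => (s.equivFin.symm (Fin.cast hs.symm i) : A), ?_⟩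
  have hrange : Set.range (fun i : Fin I.spanFinrank => (s.equivFin.symm (Fin.cast hs.symm i) : A)) = (s : Set A) := by
    ext a
    constructor
    · rintro ⟨i, rfl⟩
      exact Finset.coe_mem _
    · intro ha
      refine ⟨Fin.cast hs (s.equivFin ⟨a, ha⟩), ?_⟩
      simp
  rw [hrange]
  exact hspan

/-- `range (Fin.append g y) = range g ∪ range y`. [folklore; AI-written] -/
theorem range_fin_append {α : Type u} {m s : ℕ} (g : Fin m → α) (y : Fin s → α) :
    Set.range (Fin.append g y) = Set.range g ∪ Set.range y := by
  ext a
  constructor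
  · rintro ⟨i, rfl⟩
    refine Fin.addCases (fun j => ?_) (fun j => ?_) i
    · exact Or.inl ⟨j, (Fin.append_left g y j).symm⟩
    · exact Or.inr ⟨j, (Fin.append_right g y j).symm⟩
  · rintro (⟨j, rfl⟩ | ⟨j, rfl⟩)
    · exact ⟨Fin.castAdd s j, Fin.append_left g y j⟩
    · exact ⟨Fin.natAdd m j, Fin.append_right g y j⟩

/-! ## The theorem -/

/-- **[OURS · L1 W4.2] 2.14♯ for an arbitrary permissible centre, numerical form — the binder
`Moving.Theorem314_geomDir` DISCHARGED from printed facts**: F-51′ ([H4] Th. IV, general centre), F-52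
([H5] Th. 1 Cor.), F-50b (Mizutani 1973), F-split (Hironaka–Grothendieck isomorphism, HIO Cor. (21.11) = CJS Thm.
3.2 (2)) and CJS Thm. 3.14 as printed (branch `char k(x) = 0`) — all taken as hypotheses BY NAME — imply: for
`X` excellent, `D` permissible, `π` the blow-up in `D`, `x ∈ D` with `char k(x) = 0 ∨ ē_x(X) + 2 ≤ 2·char k(x)`,
and `x'` over `x` near to `x`, one has `dim 𝒪_{D,x} < e_x(X)`. Route (positive characteristic): chart `(t, u)` of
the exceptional divisor at `x'`; minimal generators `g` of `I_{D,x}` and a lift `y` of a regular system of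
parameters of `𝒪_{D,x}`; F-split gives `J_z = J_D · k[Z]`, hence `emb.dim = μ(I) + dim 𝒪_{D,x}`,
`e_x(X) ≥ e(C_{X,D,x}) + dim 𝒪_{D,x}` and `ē(C_{X,D,x}) ≤ ē_x(X)`; F-51′ and T7's `directrixSpace_le_prime_of_facts`
give `𝒯(J_D) ⊆ 𝔭_{x'}`, which misses a variable, so `e(C_{X,D,x}) ≥ 1`. [OURS · L1 W4.2] new-combination; NOT a
statement of any source; AI-written, weaker than expert review. -/
theorem theorem314_geomDir_of_facts (h51 : Hironaka1970_thmIV.{u})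
    (h52 : ∀ (p : ℕ) [Fact p.Prime], Hironaka1970_thm1_cor.{u} p)
    (h50b : ∀ (p : ℕ) [Fact p.Prime], Mizutani1973_vectorGroup_of_dim_le.{u} p)
    (hsplit : HerrmannIkedaOrbanz1988_cor_21_11.{u})
    (h314 : CossartJannsenSaito2020_thm_3_14.{u}) :
    Moving.Theorem314_geomDir.{u} := by
  intro X X' _ _ π D N x' x hexc hperm hπ hdim hxx' hxD hgeo hnear
  subst hxx'
  set A := X.presheaf.stalk (π.base x') with hA
  set K := ResidueField A with hK
  -- the branch `char k(x) = 0`: CJS Thm. 3.14 as printed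
  by_cases hc0 : ringChar K = 0
  · have hCH : CharHypothesis X (π.base x') := by
      obtain ⟨d, hd⟩ := exists_nat_topologicalKrullDim_eq (π.base x') hdim
      exact ⟨d, hd, Or.inl hc0⟩
    exact h314 X X' π D hexc hperm hπ N hdim x' hxD hCH hnear
  -- positive characteristic `p`, `ē_x(X) + 2 ≤ 2p`
  have hgeom : Scheme.geomDirDim X (π.base x') + 2 ≤ 2 * ringChar K := hgeo.resolve_left hc0
  set p := ringChar K with hp
  haveI : CharP K p := ringChar.charP K
  haveI hpp : Fact p.Prime := ⟨CharP.char_prime_of_ne_zero K hc0⟩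
  set B := X'.presheaf.stalk x' with hB
  set φ : A →+* B := (π.stalkMap x').hom with hφ
  haveI : IsLocalHom φ := π.toLRSHom.prop x'
  -- the permissible centre at `x`
  set I : Ideal A := stalkIdeal D (π.base x') with hI
  have hIperm : I.IsPermissible := hperm _ hxD
  haveI hreg : IsRegularLocalRing (A ⧸ I) := hIperm.isRegularLocalRing
  -- the chart of the exceptional divisor at `x'`
  obtain ⟨t, ht, hspan⟩ := hπ.isEffectiveCartier.exists_stalkIdeal_eq_span x'
  have hmap : I.map φ = Ideal.span {t} := by
    rw [← hspan, stalkIdeal_comap_eq_map_stalkMap]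
  -- minimal generators of `I`; `μ(I) ≥ 1` since `I` lies in no minimal prime
  obtain ⟨g₀, hg₀⟩ := exists_fun_span_eq_of_fg (I := I) (IsNoetherian.noetherian I)
  have hmpos : 0 < I.spanFinrank := by
    by_contra h0
    have h0' : I.spanFinrank = 0 := by omega
    have hIbot : I = ⊥ := by
      rw [← hg₀, Ideal.span_eq_bot]
      rintro _ ⟨i, rfl⟩
      exact Fin.elim0 (Fin.cast h0' i)
    obtain ⟨q, hq, -⟩ := Ideal.exists_minimalPrimes_le (I := (⊥ : Ideal A)) (J := maximalIdeal A) bot_le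
    exact hIperm.not_le_of_mem_minimalPrimes hq (hIbot ▸ bot_le)
  obtain ⟨n, hn⟩ : ∃ n, I.spanFinrank = n + 1 := ⟨_, (Nat.succ_pred_eq_of_pos hmpos).symm⟩
  set g : Fin (n + 1) → A := g₀ ∘ Fin.cast hn.symm with hg
  have hgI : Ideal.span (Set.range g) = I := by
    have hsurj : Function.Surjective (Fin.cast hn.symm) := fun i => ⟨Fin.cast hn i, by simp⟩
    rw [hg, hsurj.range_comp]
    exact hg₀
  have hm : (Ideal.span (Set.range g)).spanFinrank = n + 1 := by rw [hgI, hn]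
  -- `π^♯(g_i) = u_i t`
  have hu : ∀ i, ∃ ui : B, φ (g i) = ui * t := by
    intro i
    have hmem : φ (g i) ∈ I.map φ := by
      refine Ideal.mem_map_of_mem φ ?_
      rw [← hgI]
      exact Ideal.subset_span ⟨i, rfl⟩
    rw [hmap, Ideal.mem_span_singleton'] at hmem
    obtain ⟨ui, hui⟩ := hmem
    exact ⟨ui, hui.symm⟩
  choose u hu using hu
  -- a lift `y` of a regular system of parameters of `A ⧸ I`
  set s := (maximalIdeal (A ⧸ I)).spanFinrank with hs
  have hdimI : ringKrullDim (A ⧸ I) = (s : WithBot ℕ∞) := hreg.spanFinrank_maximalIdeal.symm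
  obtain ⟨ybar, hybar⟩ := exists_span_range_eq_maximalIdeal (A ⧸ I) (e := s) le_rfl
  have hy' : ∀ i, ∃ yi : A, Ideal.Quotient.mk I yi = ybar i := fun i => Ideal.Quotient.mk_surjective (ybar i)
  choose y hy using hy'
  have hz : Ideal.span (Set.range (Fin.append g y)) = maximalIdeal A := by
    have hcomap : (maximalIdeal (A ⧸ I)).comap (Ideal.Quotient.mk I) = maximalIdeal A :=
      IsLocalRing.eq_maximalIdeal
        (Ideal.comap_isMaximal_of_surjective _ Ideal.Quotient.mk_surjective)
    have hybar' : Ideal.span (Set.range ybar) = (Ideal.span (Set.range y)).map (Ideal.Quotient.mk I) := by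
      have hfun : ybar = (Ideal.Quotient.mk I) ∘ y := funext fun i => (hy i).symm
      rw [Ideal.map_span, ← Set.range_comp, hfun]
    rw [range_fin_append, Ideal.span_union, hgI, ← hcomap, ← hybar, hybar',
      Ideal.comap_map_of_surjective _ Ideal.Quotient.mk_surjective]
    rw [sup_comm]
    congr 1
    exact (Ideal.mk_ker (I := I)).symm
  -- F-split: `J_z = J_D · k[Z]`
  have hJz := hsplit A I (n + 1) s g y hz hgI hreg hIperm.isNormallyFlat hdimI
  -- hence `z` is a minimal system of generators of `𝔪`
  have hE : (maximalIdeal A).spanFinrank = (n + 1) + s :=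
    spanFinrank_maximalIdeal_eq_of_tangentConeIdeal_eq hm hz hJz
  -- F-51′: `J_D` is generated inside `U(𝔭_{x'})`
  set JD := normalConeIdeal g with hJD
  set 𝔭 := Literature.RingTheory.HilbertSamuel.chartPrime φ u with h𝔭
  have h51' : JD ≤ Ideal.span ((JD : Set (MvPolynomial (Fin (n + 1)) K)) ∩
      (multAlgebra K 𝔭 : Set (MvPolynomial (Fin (n + 1)) K))) :=
    h51 X X' π D N x' (π.base x') hexc hperm hπ hdim rfl hxD hnear (n + 1) g t u hgI hn ht hmap hu
  -- `𝔭_{x'}` is a point of `ℙ(N_{D,x})`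
  haveI : 𝔭.IsPrime := isPrime_chartPrime φ u
  obtain ⟨i₀, hi₀⟩ := exists_X_not_mem_chartPrime_of_map_eq φ hgI ht hmap hu
  have hpt : IsPoint K 𝔭 := by
    refine ⟨isPrime_chartPrime φ u, fun f hf d => homogeneousComponent_mem_chartPrime φ u hf d, ?_⟩
    intro hle
    exact hi₀ (hle (by simp [irrelevant]))
  -- `ē(C_{X,D,x}) ≤ ē_x(X)`, so `ē(C_{X,D,x}) + 2 ≤ 2p`
  set Kbar := AlgebraicClosure K with hKbar
  haveI : PerfectRing Kbar p := PerfectField.toPerfectRing p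
  have hgeomA : Scheme.geomDirDim X (π.base x') = directrixDim ((tangentConeIdeal (Fin.append g y) hz).map
      (MvPolynomial.map (algebraMap K Kbar))) :=
    dirDimOver_eq' A Kbar hE (Fin.append g y) hz
  have hdir : directrixDim (JD.map (MvPolynomial.map (algebraMap K Kbar))) + 2 ≤ 2 * p := by
    have h1 := directrixDim_add_le_directrixDim_map_rename s (JD.map (MvPolynomial.map (algebraMap K Kbar)))
    rw [← map_map_rename_eq, ← hJz, ← hgeomA] at h1
    calc directrixDim (JD.map (MvPolynomial.map (algebraMap K Kbar))) + 2
        ≤ Scheme.geomDirDim X (π.base x') + 2 := by omega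
      _ ≤ 2 * p := hgeom
  -- the core (T7): `𝒯(J_D) ⊆ 𝔭_{x'}`, which misses `X_{i₀}`; so `e(C_{X,D,x}) ≥ 1`
  have hcore : ∀ L ∈ directrixSpace JD, L ∈ 𝔭 := fun L hL =>
    directrixSpace_le_prime_of_facts p Kbar (h52 p) (h50b p) hpt h51' hdir hL
  have hone : 1 ≤ directrixDim JD :=
    one_le_directrixDim_of_not_mem ((mem_homogeneousSubmodule 1 _).mpr (isHomogeneous_X K i₀))
      fun h => hi₀ (hcore _ h)
  -- `e_x(X) = e(J_z) ≥ e(J_D) + s ≥ 1 + s`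
  have hdirDim : Scheme.dirDim X (π.base x') = directrixDim (tangentConeIdeal (Fin.append g y) hz) :=
    dirDim_eq' A hE (Fin.append g y) hz
  have hes : s + 1 ≤ Scheme.dirDim X (π.base x') := by
    have h1 := directrixDim_add_le_directrixDim_map_rename s JD
    rw [← hJz, ← hdirDim] at h1
    omega
  -- conclusion
  have hlt : s < Scheme.dirDim X (π.base x') := by omega
  show ringKrullDim (A ⧸ I) < (Scheme.dirDim X (π.base x') : WithBot ℕ∞)
  rw [hdimI]
  exact_mod_cast hlt

/-- **The same with F-52 DISCHARGED** (res-D-lib-1's `HironakaScheme.Hironaka1970_thm1_cor_holds`, p515415: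
«`U(𝔭)` is generated by additive forms», PROVED): `Moving.Theorem314_geomDir` from F-51′, F-50b, F-split and CJS
Thm. 3.14 as printed. (F-50b is itself a tree theorem from F-52 —
`Summit.ResolutionOfSingularities.KangarooAtlas.Mizutani.mizutani1973_vectorGroup_of_dim_le_of_hironaka p
(Hironaka1970_thm1_cor_holds p)`, `Summits/ResolutionOfSingularities/KangarooAtlas/MizutaniVectorGroup.lean` —
to be supplied by a consumer that may import that module; this Theorems file keeps to Literature/Theorems/Theses
imports.) [OURS · L1 W4.2; AI-written] -/
theorem theorem314_geomDir_of_facts_of_mizutani (h51 : Hironaka1970_thmIV.{u})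
    (h50b : ∀ (p : ℕ) [Fact p.Prime], Mizutani1973_vectorGroup_of_dim_le.{u} p)
    (hsplit : HerrmannIkedaOrbanz1988_cor_21_11.{u})
    (h314 : CossartJannsenSaito2020_thm_3_14.{u}) :
    Moving.Theorem314_geomDir.{u} :=
  theorem314_geomDir_of_facts h51 Hironaka1970_thm1_cor_holds h50b hsplit h314

end Summit.ResolutionOfSingularities.ResolutionOfSingularities.Theorems.SigmaMaxModificationsCorridor3.Directrix214Sharp

end
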